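import Summits.QuantumFields.YangMills.Theorems.BalabanLadderNTCumulantPolarisation
import Summits.QuantumFields.YangMills.Theorems.BalabanLadderUVSeamRecFloorsEngineOfBareMirror
import Summits.QuantumFields.YangMills.Theorems.PencilRigidityDiagonalMirrorRPRStubRpClosureSupport
import HarnessLib

/-!
# Crux `UVSeamRec` (stmt-QuantumFields-20043), stub `stub_floorsEngine` (S-B): CHECK-LEMMA — the registered statement
# from {BL6, ONE clause-(ii) floor in MIRROR SHAPE, a four-point ceiling} at `rF` (card `cumulant-polarisation`)

Helper file (`--supports stmt-QuantumFields-20043`; owner RULINGS R78/R87) of the fleet lead `ym-spine-19353-p1`,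
sequel of `…NTCumulantPolarisation` (crux-ideate card 10, seat `ym-cruxidea-19353-2`): the asymptotic packaging along
a unit map and the specialisation «last file» to `(SU(2), rF = fundamentalLatticeRep 2, a/uRec → c₀)`.
WHICH CLAUSES IT SUPPLIES: BOTH conjunct 2 (two-point floor, through the R87 residual MF(4ε) with `4ε = ε₃²/M`) AND
conjunct 3 (three-point floor, witnesses `(v, θg, θh)`) of the REGISTERED `UVSeamRec.stub_floorsEngine`, from ONE
sign-sensitive input:

* (Q3M) `ε₃ ≤ |Q3 G r β L (aβ) v (θg) (θh)|` on every torus `aβ·L ≥ Λ₅` — the clause-(ii) floor with its three test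
  functions in MIRROR SHAPE (`v, g, h` compactly supported at positive times, `g ⟂ h`, one cube family carrying their
  lattice supports at depth `≥ 2`);
* (4C) `B(P_β, P_β) ≤ M` — a size-only four-point CEILING for the centred product `P_β` of the two reflected smearings
  (MomentBounds-class);
plus the unit clauses and (BL6) as in `MarkovMirrorFloors.stubFloorsEngine_of_bareFloor_rF` (p518416).

* `bareFloors_of_Q3_floors` — (Q3M) ∧ (4C) ⇒ the MF(ε₃²/M) family (general `(G, r, a)`; `…CumulantPolarisation.bareFloor_of_Q3_floor`);
* `disjoint_tsupport_pos_theta`, `disjoint_tsupport_theta_theta` — the mirror-shape witnesses are admissible for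
  conjunct 3; `floorsThreePoint_of_Q3MirrorFloor` — conjunct 3 VERBATIM (compact supports via
  `RpClosure.hasCompactSupport_thetaTest`); `floorsTwoPoint_of_Q3MirrorFloor` — conjunct 2 (general `(G, r, a)`);
* `stubFloorsEngine_of_Q3MirrorFloor_rF` — the REGISTERED v5(α)/v4-F `stub_floorsEngine` statement VERBATIM.

HONEST FRAMING.  Bookkeeping on a conditional chain; (Q3M) (a `g⋆⁴`-sized connected three-point floor at physical
separations — dimensional transmutation), (4C) and BL6 are engine-grade OPEN (crux `NT`; barrier
`PerturbativeInvisibility`); nothing `SU(2)`-specific beyond the instantiation; not a claim about NT or the gap.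
[cite: FrohlichIsraelLiebSimon1978, Thm. 2.1; OsterwalderSeiler1978, §2]
-/

set_option autoImplicit false

noncomputable section

open scoped SchwartzMap
open MeasureTheory Filter Topology
open Literature.MathematicalPhysics.QuantumFieldTheory Literature.MathematicalPhysics.QuantumLattice
open Literature.Probability.LatticeModels
open Summit.QuantumFields.YangMills.Cruxes.OSLegsFromFemtoAndGap.DlrCollarTransfer
open Summit.QuantumFields.YangMills.Cruxes.OSLegsFromFemtoAndGap.DlrCollarTransfer.StubLower (mem_cubeSites_iff)
open Summit.QuantumFields.YangMills.Cruxes.NT.MarkovMirror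
open Summit.QuantumFields.YangMills.Cruxes.NT.CumulantPolarisation
open Summit.QuantumFields.YangMills.Cruxes.DiagonalMirrorRPR.ParityBridgeColdTraces.RpClosure (hasCompactSupport_thetaTest)

namespace Summit.QuantumFields.YangMills.Cruxes.UVSeamRec.Q3MirrorFloors

/-! ## §1 Along a unit map: (Q3M) ∧ (4C) ⇒ the MF family; the mirror-shape witnesses (general `(G, r, a)`) -/

section General

variable (G : Type) [Group G] [TopologicalSpace G] [IsTopologicalGroup G] [CompactSpace G]
  [MeasurableSpace G] [BorelSpace G] (r : LatticeRep G)

/-- **(MF) along a unit map from the (ii)-mirror floor and the four-point ceiling.**  A unit map `a > 0`; test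
functions `v, g, h`; for `β ≥ β₅`: a cube `Q_β = (c β, b β)` at times `≥ 1` of physical size
`(|c β j| + b β + 3)·aβ ≤ Λ₅` carrying the lattice supports of `v(aβ·), g(aβ·), h(aβ·)` at depth `≥ 2`; the floor
`ε₃ ≤ |Q3 G r β L (a β) v (θg) (θh)|` and the ceiling `B(P_β, P_β) ≤ M` on every torus `Λ₅ ≤ aβ·L`.  Then the bare
mirror floor (MF) of `MarkovMirror.nt_of_bareFloor_chiral` holds with `4ε = ε₃²/M`, for `β ≥ max β₅ 0`. [folklore] -/
theorem bareFloors_of_Q3_floors (a : ℝ → ℝ) (ha₀ : ∀ β, 0 < a β) (v g h : 𝓢(EuclideanSpace ℝ (Fin 4), ℝ))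
    {ε₃ M β₅ Λ₅ : ℝ} (hε₃ : 0 < ε₃) (c : ℝ → (Fin 4 → ℤ)) (b : ℝ → ℕ)
    (hgeom : ∀ β, β₅ ≤ β → 1 ≤ c β 0 ∧ ∀ j : Fin 4, (|((c β j : ℤ) : ℝ)| + (b β : ℝ) + 3) * a β ≤ Λ₅)
    (hv : ∀ β, β₅ ≤ β → ∀ x : Fin 4 → ℤ, v (a β • siteToE x) ≠ 0 →
      x ∈ cubeSites (c β) (b β) ∧ 2 ≤ depth (c β) (b β) x)
    (hg : ∀ β, β₅ ≤ β → ∀ y : Fin 4 → ℤ, g (a β • siteToE y) ≠ 0 →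
      y ∈ cubeSites (c β) (b β) ∧ 2 ≤ depth (c β) (b β) y)
    (hh : ∀ β, β₅ ≤ β → ∀ z : Fin 4 → ℤ, h (a β • siteToE z) ≠ 0 →
      z ∈ cubeSites (c β) (b β) ∧ 2 ≤ depth (c β) (b β) z)
    (hfloor : ∀ β, β₅ ≤ β → ∀ L : ℕ, Λ₅ ≤ a β * L → ε₃ ≤ |Q3 G r β L (a β) v (thetaTest 4 g) (thetaTest 4 h)|)
    (hceil : ∀ β, β₅ ≤ β → ∀ L : ℕ, Λ₅ ≤ a β * L →
      mirrorForm G r β L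
        (cprod G r β L (reflSmear G r (c β) (b β) fun y => g (a β • siteToE y))
          (reflSmear G r (c β) (b β) fun z => h (a β • siteToE z)))
        (cprod G r β L (reflSmear G r (c β) (b β) fun y => g (a β • siteToE y))
          (reflSmear G r (c β) (b β) fun z => h (a β • siteToE z))) ≤ M) :
    ∀ β, max β₅ 0 ≤ β → ∀ L : ℕ, Λ₅ ≤ a β * L →
      4 * (ε₃ ^ 2 / (4 * M)) ≤ torusE G r β L (fun V =>
          (∑ y ∈ cubeSites (c β) (b β), v (a β • siteToE y) * dens G r y (cfgReflect V)) *
            ∑ y ∈ cubeSites (c β) (b β), v (a β • siteToE y) * dens G r y V) -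
        torusE G r β L (fun V => ∑ y ∈ cubeSites (c β) (b β), v (a β • siteToE y) * dens G r y (cfgReflect V)) *
          torusE G r β L (fun V => ∑ y ∈ cubeSites (c β) (b β), v (a β • siteToE y) * dens G r y V) := by
  intro β hβ L hL
  have hβ₅ : β₅ ≤ β := le_trans (le_max_left _ _) hβ
  have hβ0 : 0 ≤ β := le_trans (le_max_right _ _) hβ
  obtain ⟨hc0, hsize⟩ := hgeom β hβ₅
  obtain ⟨hcL3, hc⟩ := torusFit_of_geom (ha₀ β) hsize hL
  have hcL : c β 0 + (b β : ℤ) + 1 ≤ L := by linarith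
  have hsub : cubeSites (c β) (b β) ⊆ box 4 L := fun y hy => by
    rw [mem_box]
    intro j
    have h1 := (mem_cubeSites_iff _ _ _).1 hy j
    have h2 := hc j
    constructor <;> linarith [h1.1, h1.2, h2.1, h2.2]
  obtain ⟨hM0, key⟩ := bareFloor_of_Q3_floor G r hβ0 (c β) (b β) L hc0 hcL hsub (a β) v g h
    (fun x hx => (hv β hβ₅ x hx).1) (hg β hβ₅) (hh β hβ₅) hε₃ (hfloor β hβ₅ L hL) (hceil β hβ₅ L hL)
  have e : 4 * (ε₃ ^ 2 / (4 * M)) = ε₃ ^ 2 / M := by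
    field_simp
  rw [e]
  exact key


/-- The `tsupport` of `θf` lies in the reflection preimage of the `tsupport` of `f`. [folklore] -/
theorem tsupport_thetaTest_subset_preimage (f : 𝓢(EuclideanSpace ℝ (Fin 4), ℝ)) :
    tsupport (thetaTest 4 f : EuclideanSpace ℝ (Fin 4) → ℝ) ⊆
      (timeReflection 4) ⁻¹' tsupport (f : EuclideanSpace ℝ (Fin 4) → ℝ) := by
  have hK : IsClosed ((timeReflection 4) ⁻¹' tsupport (f : EuclideanSpace ℝ (Fin 4) → ℝ)) :=
    (isClosed_tsupport _).preimage (timeReflection 4).continuous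
  have hsub : Function.support (thetaTest 4 f) ⊆ (timeReflection 4) ⁻¹' tsupport (f : EuclideanSpace ℝ (Fin 4) → ℝ) := by
    intro y hy
    rw [Function.mem_support, thetaTest_apply] at hy
    exact subset_tsupport _ (Function.mem_support.2 hy)
  exact closure_minimal hsub hK

/-- A positive-time test function and the reflection of a positive-time test function have disjoint `tsupport`s.
[folklore] -/
theorem disjoint_tsupport_pos_theta {v g : 𝓢(EuclideanSpace ℝ (Fin 4), ℝ)}
    (hv : tsupport (v : EuclideanSpace ℝ (Fin 4) → ℝ) ⊆ {y | 0 < y 0})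
    (hg : tsupport (g : EuclideanSpace ℝ (Fin 4) → ℝ) ⊆ {y | 0 < y 0}) :
    Disjoint (tsupport (v : EuclideanSpace ℝ (Fin 4) → ℝ)) (tsupport (thetaTest 4 g : EuclideanSpace ℝ (Fin 4) → ℝ)) := by
  refine Set.disjoint_left.2 fun y hyv hyg => ?_
  have h1 : 0 < y 0 := hv hyv
  have h2 := hg (tsupport_thetaTest_subset_preimage g hyg)
  simp only [Set.mem_setOf_eq, Literature.MathematicalPhysics.QuantumLattice.timeReflection_apply] at h2
  have h3 : y 0 < 0 := by simpa using h2
  linarith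

/-- Reflections of test functions with disjoint `tsupport`s have disjoint `tsupport`s. [folklore] -/
theorem disjoint_tsupport_theta_theta {g h : 𝓢(EuclideanSpace ℝ (Fin 4), ℝ)}
    (hgh : Disjoint (tsupport (g : EuclideanSpace ℝ (Fin 4) → ℝ)) (tsupport (h : EuclideanSpace ℝ (Fin 4) → ℝ))) :
    Disjoint (tsupport (thetaTest 4 g : EuclideanSpace ℝ (Fin 4) → ℝ))
      (tsupport (thetaTest 4 h : EuclideanSpace ℝ (Fin 4) → ℝ)) :=
  (hgh.preimage (timeReflection 4)).mono (tsupport_thetaTest_subset_preimage g) (tsupport_thetaTest_subset_preimage h)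

/-- **Conjunct 3 (three-point floor) of `UVSeamRec.stub_floorsEngine` from the (ii)-floor in mirror shape itself** —
witnesses `(v, θg, θh)`: compactly supported (reflection preserves compact support), pairwise disjoint `tsupport`s
(`v` at positive, `θg, θh` at negative times; `g ⟂ h`).  General `(G, r, a)`. [folklore] -/
theorem floorsThreePoint_of_Q3MirrorFloor (a : ℝ → ℝ) (v g h : 𝓢(EuclideanSpace ℝ (Fin 4), ℝ))
    (hvK : HasCompactSupport (v : EuclideanSpace ℝ (Fin 4) → ℝ))
    (hgK : HasCompactSupport (g : EuclideanSpace ℝ (Fin 4) → ℝ))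
    (hhK : HasCompactSupport (h : EuclideanSpace ℝ (Fin 4) → ℝ))
    (hv : tsupport (v : EuclideanSpace ℝ (Fin 4) → ℝ) ⊆ {y | 0 < y 0})
    (hgs : tsupport (g : EuclideanSpace ℝ (Fin 4) → ℝ) ⊆ {y | 0 < y 0})
    (hhs : tsupport (h : EuclideanSpace ℝ (Fin 4) → ℝ) ⊆ {y | 0 < y 0})
    (hgh : Disjoint (tsupport (g : EuclideanSpace ℝ (Fin 4) → ℝ)) (tsupport (h : EuclideanSpace ℝ (Fin 4) → ℝ)))
    {ε₃ β₅ Λ₅ : ℝ} (hε₃ : 0 < ε₃)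
    (hfloor : ∀ β, β₅ ≤ β → ∀ L : ℕ, Λ₅ ≤ a β * L → ε₃ ≤ |Q3 G r β L (a β) v (thetaTest 4 g) (thetaTest 4 h)|) :
    ∃ (f g h : 𝓢(EuclideanSpace ℝ (Fin 4), ℝ)) (ε β₅ Λ₅ : ℝ),
      HasCompactSupport (f : EuclideanSpace ℝ (Fin 4) → ℝ) ∧
      HasCompactSupport (g : EuclideanSpace ℝ (Fin 4) → ℝ) ∧
      HasCompactSupport (h : EuclideanSpace ℝ (Fin 4) → ℝ) ∧
      Disjoint (tsupport (f : EuclideanSpace ℝ (Fin 4) → ℝ)) (tsupport (g : EuclideanSpace ℝ (Fin 4) → ℝ)) ∧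
      Disjoint (tsupport (g : EuclideanSpace ℝ (Fin 4) → ℝ)) (tsupport (h : EuclideanSpace ℝ (Fin 4) → ℝ)) ∧
      Disjoint (tsupport (f : EuclideanSpace ℝ (Fin 4) → ℝ)) (tsupport (h : EuclideanSpace ℝ (Fin 4) → ℝ)) ∧
      0 < ε ∧ ∀ β : ℝ, β₅ ≤ β → ∀ L : ℕ, Λ₅ ≤ a β * L → ε ≤ |Q3 G r β L (a β) f g h| :=
  ⟨v, thetaTest 4 g, thetaTest 4 h, ε₃, β₅, Λ₅, hvK, hasCompactSupport_thetaTest hgK, hasCompactSupport_thetaTest hhK,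
    disjoint_tsupport_pos_theta hv hgs, disjoint_tsupport_theta_theta hgh, disjoint_tsupport_pos_theta hv hhs, hε₃,
    hfloor⟩

/-- **`0 < M` is forced** by (Q3M) ∧ (4C) at one large torus of one coupling (the floor is non-vacuous: `aβ > 0`).
[folklore] -/
theorem ceiling_pos_of_Q3_floors (a : ℝ → ℝ) (ha₀ : ∀ β, 0 < a β) (v g h : 𝓢(EuclideanSpace ℝ (Fin 4), ℝ))
    {ε₃ M β₅ Λ₅ : ℝ} (hε₃ : 0 < ε₃) (hβ₅ : 0 ≤ β₅) (c : ℝ → (Fin 4 → ℤ)) (b : ℝ → ℕ)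
    (hgeom : ∀ β, β₅ ≤ β → 1 ≤ c β 0 ∧ ∀ j : Fin 4, (|((c β j : ℤ) : ℝ)| + (b β : ℝ) + 3) * a β ≤ Λ₅)
    (hv : ∀ β, β₅ ≤ β → ∀ x : Fin 4 → ℤ, v (a β • siteToE x) ≠ 0 →
      x ∈ cubeSites (c β) (b β) ∧ 2 ≤ depth (c β) (b β) x)
    (hg : ∀ β, β₅ ≤ β → ∀ y : Fin 4 → ℤ, g (a β • siteToE y) ≠ 0 →
      y ∈ cubeSites (c β) (b β) ∧ 2 ≤ depth (c β) (b β) y)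
    (hh : ∀ β, β₅ ≤ β → ∀ z : Fin 4 → ℤ, h (a β • siteToE z) ≠ 0 →
      z ∈ cubeSites (c β) (b β) ∧ 2 ≤ depth (c β) (b β) z)
    (hfloor : ∀ β, β₅ ≤ β → ∀ L : ℕ, Λ₅ ≤ a β * L → ε₃ ≤ |Q3 G r β L (a β) v (thetaTest 4 g) (thetaTest 4 h)|)
    (hceil : ∀ β, β₅ ≤ β → ∀ L : ℕ, Λ₅ ≤ a β * L →
      mirrorForm G r β L
        (cprod G r β L (reflSmear G r (c β) (b β) fun y => g (a β • siteToE y))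
          (reflSmear G r (c β) (b β) fun z => h (a β • siteToE z)))
        (cprod G r β L (reflSmear G r (c β) (b β) fun y => g (a β • siteToE y))
          (reflSmear G r (c β) (b β) fun z => h (a β • siteToE z))) ≤ M) :
    0 < M := by
  obtain ⟨L, hL⟩ := exists_nat_ge (Λ₅ / a β₅)
  have hL' : Λ₅ ≤ a β₅ * L := by
    have := ha₀ β₅
    rw [div_le_iff₀ this] at hL
    linarith [mul_comm (a β₅) (L : ℝ)]
  obtain ⟨hc0, hsize⟩ := hgeom β₅ le_rfl
  obtain ⟨hcL3, hc⟩ := torusFit_of_geom (ha₀ β₅) hsize hL'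
  have hcL : c β₅ 0 + (b β₅ : ℤ) + 1 ≤ L := by linarith
  have hsub : cubeSites (c β₅) (b β₅) ⊆ box 4 L := fun y hy => by
    rw [mem_box]
    intro j
    have h1 := (mem_cubeSites_iff _ _ _).1 hy j
    have h2 := hc j
    constructor <;> linarith [h1.1, h1.2, h2.1, h2.2]
  exact (bareFloor_of_Q3_floor G r hβ₅ (c β₅) (b β₅) L hc0 hcL hsub (a β₅) v g h
    (fun x hx => (hv β₅ le_rfl x hx).1) (hg β₅ le_rfl) (hh β₅ le_rfl) hε₃ (hfloor β₅ le_rfl L hL')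
    (hceil β₅ le_rfl L hL')).1

/-- **Conjunct 2 (two-point floor) of `UVSeamRec.stub_floorsEngine` from {RBLΔ, (Q3M), (4C)}** (general `(G, r, a)`):
`MarkovMirror.floorsTwoPoint_of_bareFloor_chiral` (p517197) with (MF) := `bareFloors_of_Q3_floors`, `ε := ε₃²/(4M)`,
(RBLΔ) at tolerance `√(ε₃²/(4M))/2`. [folklore] -/
theorem floorsTwoPoint_of_Q3MirrorFloor (a : ℝ → ℝ) (ha₀ : ∀ β, 0 < a β)
    (v g h : 𝓢(EuclideanSpace ℝ (Fin 4), ℝ)) (hvK : HasCompactSupport (v : EuclideanSpace ℝ (Fin 4) → ℝ))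
    (hvs : tsupport (v : EuclideanSpace ℝ (Fin 4) → ℝ) ⊆ {y | 0 < y 0})
    {ε₃ M β₅ Λ₅ : ℝ} (hε₃ : 0 < ε₃) (hβ₅ : 0 ≤ β₅) (c : ℝ → (Fin 4 → ℤ)) (b : ℝ → ℕ) (p' : ℝ → ℝ)
    (hgeom : ∀ β, β₅ ≤ β → 1 ≤ c β 0 ∧ ∀ j : Fin 4, (|((c β j : ℤ) : ℝ)| + (b β : ℝ) + 3) * a β ≤ Λ₅)
    (hv : ∀ β, β₅ ≤ β → ∀ x : Fin 4 → ℤ, v (a β • siteToE x) ≠ 0 →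
      x ∈ cubeSites (c β) (b β) ∧ 2 ≤ depth (c β) (b β) x)
    (hg : ∀ β, β₅ ≤ β → ∀ y : Fin 4 → ℤ, g (a β • siteToE y) ≠ 0 →
      y ∈ cubeSites (c β) (b β) ∧ 2 ≤ depth (c β) (b β) y)
    (hh : ∀ β, β₅ ≤ β → ∀ z : Fin 4 → ℤ, h (a β • siteToE z) ≠ 0 →
      z ∈ cubeSites (c β) (b β) ∧ 2 ≤ depth (c β) (b β) z)
    (hΔ : ∀ β, β₅ ≤ β → ∀ ζ,
      |kerE G r β (c β) (b β) ζ (fun V => ∑ x ∈ cubeSites (c β) (b β), v (a β • siteToE x) *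
          ∑ q : {q : Fin 4 × Fin 4 // q.1 < q.2}, plane G r q.1 (if q.1.1 = 0 then x - Pi.single 0 1 else x) V) -
        kerE G r β (c β) (b β) ζ (fun V => ∑ y ∈ cubeSites (c β) (b β), v (a β • siteToE y) * dens G r y V) -
        p' β| ≤ Real.sqrt (ε₃ ^ 2 / (4 * M)) / 2)
    (hfloor : ∀ β, β₅ ≤ β → ∀ L : ℕ, Λ₅ ≤ a β * L → ε₃ ≤ |Q3 G r β L (a β) v (thetaTest 4 g) (thetaTest 4 h)|)
    (hceil : ∀ β, β₅ ≤ β → ∀ L : ℕ, Λ₅ ≤ a β * L →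
      mirrorForm G r β L
        (cprod G r β L (reflSmear G r (c β) (b β) fun y => g (a β • siteToE y))
          (reflSmear G r (c β) (b β) fun z => h (a β • siteToE z)))
        (cprod G r β L (reflSmear G r (c β) (b β) fun y => g (a β • siteToE y))
          (reflSmear G r (c β) (b β) fun z => h (a β • siteToE z))) ≤ M) :
    ∃ (v : 𝓢(EuclideanSpace ℝ (Fin 4), ℝ)) (ε β₅ Λ₅ : ℝ),
      HasCompactSupport (v : EuclideanSpace ℝ (Fin 4) → ℝ) ∧
      tsupport (v : EuclideanSpace ℝ (Fin 4) → ℝ) ⊆ {y : EuclideanSpace ℝ (Fin 4) | 0 < y 0} ∧ 0 < ε ∧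
      ∀ β : ℝ, β₅ ≤ β → ∀ L : ℕ, Λ₅ ≤ a β * L → ε ≤ Q2 G r β L (a β) (thetaTest 4 v) v := by
  have hM0 := ceiling_pos_of_Q3_floors G r a ha₀ v g h hε₃ hβ₅ c b hgeom hv hg hh hfloor hceil
  have hε : 0 < ε₃ ^ 2 / (4 * M) := by positivity
  exact floorsTwoPoint_of_bareFloor_chiral G r a ha₀ v hvK hvs hε (β₅ := max β₅ 0) c b p'
    (fun β hβ => hgeom β (le_of_max_le_left hβ)) (fun β hβ => hv β (le_of_max_le_left hβ))
    (fun β hβ ζ => hΔ β (le_of_max_le_left hβ) ζ)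
    (bareFloors_of_Q3_floors G r a ha₀ v g h hε₃ c b hgeom hv hg hh hfloor hceil)

end General

/-! ## §2 The REGISTERED `stub_floorsEngine` statement at `(SU(2), rF)` from {BL6, (Q3M), (4C)} -/

open Summit.QuantumFields.YangMills.Cruxes.UVSeamRec.MarkovMirrorFloors (stubFloorsEngine_of_bareFloor_rF)

/-- **CHECK-LEMMA: the REGISTERED v5(α)/v4-F `UVSeamRec.stub_floorsEngine` statement from ONE floor at `rF`.**  For
`SU(2)` with its Borel σ-algebra: a unit map `a > 0` with `a β / uRec β → c₀ > 0`; three compactly supported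
positive-time test functions `v, g, h` with `g ⟂ h`; `ε₃ > 0`, `κ > 0`, `C₁ ≥ 0`, `β₅ ≥ 0`, a constant `M`; per coupling
`β ≥ β₅` ONE positive-time cube `Q_β` of physical size `≤ Λ₅` carrying the lattice supports of `v(aβ·), g(aβ·), h(aβ·)`
at depth `≥ 2` and the `e₀`-thickening of `supp v(aβ·)` at physical depth `≥ κ`; (BL6) the one-plaquette boundary
law `C₁/depth⁴` there for every exterior; (Q3M) `ε₃ ≤ |Q3(aβ; v, θg, θh)|` and (4C) `B(P_β, P_β) ≤ M` on every torus
`aβ·L ≥ Λ₅`.  Then the statement of `stub_floorsEngine` holds — BOTH its conjuncts from the one floor (Q3M):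
conjunct 3 with witnesses `(v, θg, θh)`, conjunct 2 through MF(ε₃²/M) (`bareFloors_of_Q3_floors`) and p518416
(whose (RBLΔ) input it derives from (BL6) at any positive tolerance). [cite: FrohlichIsraelLiebSimon1978, Thm. 2.1] -/
theorem stubFloorsEngine_of_Q3MirrorFloor_rF
    (hyp : letI : MeasurableSpace (Matrix.specialUnitaryGroup (Fin 2) ℂ) := borel _
      haveI : BorelSpace (Matrix.specialUnitaryGroup (Fin 2) ℂ) := ⟨rfl⟩
      ∃ (a : ℝ → ℝ) (c₀ : ℝ), 0 < c₀ ∧ (∀ β, 0 < a β) ∧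
        Tendsto (fun β => a β / Transport.uRec β) atTop (𝓝 c₀) ∧
      ∃ (v g h : 𝓢(EuclideanSpace ℝ (Fin 4), ℝ)) (ε₃ M β₅ Λ₅ κ C₁ : ℝ) (c : ℝ → (Fin 4 → ℤ)) (b : ℝ → ℕ)
          (p6 : ℝ → {q : Fin 4 × Fin 4 // q.1 < q.2} → ℝ),
          HasCompactSupport (v : EuclideanSpace ℝ (Fin 4) → ℝ) ∧
          HasCompactSupport (g : EuclideanSpace ℝ (Fin 4) → ℝ) ∧
          HasCompactSupport (h : EuclideanSpace ℝ (Fin 4) → ℝ) ∧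
          tsupport (v : EuclideanSpace ℝ (Fin 4) → ℝ) ⊆ {y | 0 < y 0} ∧
          tsupport (g : EuclideanSpace ℝ (Fin 4) → ℝ) ⊆ {y | 0 < y 0} ∧
          tsupport (h : EuclideanSpace ℝ (Fin 4) → ℝ) ⊆ {y | 0 < y 0} ∧
          Disjoint (tsupport (g : EuclideanSpace ℝ (Fin 4) → ℝ)) (tsupport (h : EuclideanSpace ℝ (Fin 4) → ℝ)) ∧
          0 < ε₃ ∧ 0 ≤ β₅ ∧ 0 < κ ∧ 0 ≤ C₁ ∧
          (∀ β, β₅ ≤ β → 1 ≤ c β 0 ∧ ∀ j : Fin 4, (|((c β j : ℤ) : ℝ)| + (b β : ℝ) + 3) * a β ≤ Λ₅) ∧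
          (∀ β, β₅ ≤ β → ∀ x : Fin 4 → ℤ, v (a β • siteToE x) ≠ 0 →
            x ∈ cubeSites (c β) (b β) ∧ 2 ≤ depth (c β) (b β) x) ∧
          (∀ β, β₅ ≤ β → ∀ y : Fin 4 → ℤ, g (a β • siteToE y) ≠ 0 →
            y ∈ cubeSites (c β) (b β) ∧ 2 ≤ depth (c β) (b β) y) ∧
          (∀ β, β₅ ≤ β → ∀ z : Fin 4 → ℤ, h (a β • siteToE z) ≠ 0 →
            z ∈ cubeSites (c β) (b β) ∧ 2 ≤ depth (c β) (b β) z) ∧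
          (∀ β, β₅ ≤ β → ∀ x : Fin 4 → ℤ,
            (v (a β • siteToE x) ≠ 0 ∨ v (a β • siteToE (x + Pi.single 0 1)) ≠ 0) →
              x ∈ cubeSites (c β) (b β) ∧ κ / a β ≤ (depth (c β) (b β) x : ℝ)) ∧
          (∀ β, β₅ ≤ β → ∀ (ζ : LGConfig 4 (Matrix.specialUnitaryGroup (Fin 2) ℂ))
            (q : {q : Fin 4 × Fin 4 // q.1 < q.2}), q.1.1 = 0 → ∀ x ∈ cubeSites (c β) (b β),
              (v (a β • siteToE x) ≠ 0 ∨ v (a β • siteToE (x + Pi.single 0 1)) ≠ 0) →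
                |kerE (Matrix.specialUnitaryGroup (Fin 2) ℂ) (fundamentalLatticeRep 2) β (c β) (b β) ζ
                    (plane (Matrix.specialUnitaryGroup (Fin 2) ℂ) (fundamentalLatticeRep 2) q.1 x) - p6 β q| ≤
                  C₁ / (depth (c β) (b β) x : ℝ) ^ 4) ∧
          (∀ β, β₅ ≤ β → ∀ L : ℕ, Λ₅ ≤ a β * L →
            ε₃ ≤ |Q3 (Matrix.specialUnitaryGroup (Fin 2) ℂ) (fundamentalLatticeRep 2) β L (a β) v
              (thetaTest 4 g) (thetaTest 4 h)|) ∧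
          (∀ β, β₅ ≤ β → ∀ L : ℕ, Λ₅ ≤ a β * L →
            mirrorForm (Matrix.specialUnitaryGroup (Fin 2) ℂ) (fundamentalLatticeRep 2) β L
              (cprod (Matrix.specialUnitaryGroup (Fin 2) ℂ) (fundamentalLatticeRep 2) β L
                (reflSmear (Matrix.specialUnitaryGroup (Fin 2) ℂ) (fundamentalLatticeRep 2) (c β) (b β)
                  fun y => g (a β • siteToE y))
                (reflSmear (Matrix.specialUnitaryGroup (Fin 2) ℂ) (fundamentalLatticeRep 2) (c β) (b β)
                  fun z => h (a β • siteToE z)))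
              (cprod (Matrix.specialUnitaryGroup (Fin 2) ℂ) (fundamentalLatticeRep 2) β L
                (reflSmear (Matrix.specialUnitaryGroup (Fin 2) ℂ) (fundamentalLatticeRep 2) (c β) (b β)
                  fun y => g (a β • siteToE y))
                (reflSmear (Matrix.specialUnitaryGroup (Fin 2) ℂ) (fundamentalLatticeRep 2) (c β) (b β)
                  fun z => h (a β • siteToE z))) ≤ M)) :
    letI : MeasurableSpace (Matrix.specialUnitaryGroup (Fin 2) ℂ) := borel _
    haveI : BorelSpace (Matrix.specialUnitaryGroup (Fin 2) ℂ) := ⟨rfl⟩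
    ∃ (a : ℝ → ℝ) (c₀ : ℝ), 0 < c₀ ∧ (∀ β, 0 < a β) ∧
      Tendsto (fun β => a β / Transport.uRec β) atTop (𝓝 c₀) ∧
      (∃ (v : 𝓢(EuclideanSpace ℝ (Fin 4), ℝ)) (ε β₅ Λ₅ : ℝ),
        HasCompactSupport (v : EuclideanSpace ℝ (Fin 4) → ℝ) ∧
        tsupport (v : EuclideanSpace ℝ (Fin 4) → ℝ) ⊆ {y : EuclideanSpace ℝ (Fin 4) | 0 < y 0} ∧ 0 < ε ∧
        ∀ β : ℝ, β₅ ≤ β → ∀ L : ℕ, Λ₅ ≤ a β * L →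
          ε ≤ Q2 (Matrix.specialUnitaryGroup (Fin 2) ℂ) (fundamentalLatticeRep 2) β L (a β) (thetaTest 4 v) v) ∧
      (∃ (f g h : 𝓢(EuclideanSpace ℝ (Fin 4), ℝ)) (ε β₅ Λ₅ : ℝ),
        HasCompactSupport (f : EuclideanSpace ℝ (Fin 4) → ℝ) ∧
        HasCompactSupport (g : EuclideanSpace ℝ (Fin 4) → ℝ) ∧
        HasCompactSupport (h : EuclideanSpace ℝ (Fin 4) → ℝ) ∧
        Disjoint (tsupport (f : EuclideanSpace ℝ (Fin 4) → ℝ)) (tsupport (g : EuclideanSpace ℝ (Fin 4) → ℝ)) ∧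
        Disjoint (tsupport (g : EuclideanSpace ℝ (Fin 4) → ℝ)) (tsupport (h : EuclideanSpace ℝ (Fin 4) → ℝ)) ∧
        Disjoint (tsupport (f : EuclideanSpace ℝ (Fin 4) → ℝ)) (tsupport (h : EuclideanSpace ℝ (Fin 4) → ℝ)) ∧
        0 < ε ∧ ∀ β : ℝ, β₅ ≤ β → ∀ L : ℕ, Λ₅ ≤ a β * L →
          ε ≤ |Q3 (Matrix.specialUnitaryGroup (Fin 2) ℂ) (fundamentalLatticeRep 2) β L (a β) f g h|) := by
  letI : MeasurableSpace (Matrix.specialUnitaryGroup (Fin 2) ℂ) := borel _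
  haveI : BorelSpace (Matrix.specialUnitaryGroup (Fin 2) ℂ) := ⟨rfl⟩
  obtain ⟨a, c₀, hc₀, ha₀, hau, v, g, h, ε₃, M, β₅, Λ₅, κ, C₁, c, b, p6, hvK, hgK, hhK, hvs, hgs, hhs, hgh, hε₃, hβ₅,
    hκ, hC₁, hgeom, hv, hg, hh, hthick, hBL, hfloor, hceil⟩ := hyp
  have hM0 := ceiling_pos_of_Q3_floors (Matrix.specialUnitaryGroup (Fin 2) ℂ) (fundamentalLatticeRep 2) a ha₀ v g h
    hε₃ hβ₅ c b hgeom hv hg hh hfloor hceil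
  have hε : 0 < ε₃ ^ 2 / (4 * M) := by positivity
  have hMF := bareFloors_of_Q3_floors (Matrix.specialUnitaryGroup (Fin 2) ℂ) (fundamentalLatticeRep 2) a ha₀ v g h
    hε₃ c b hgeom hv hg hh hfloor hceil
  exact stubFloorsEngine_of_bareFloor_rF ⟨a, c₀, hc₀, ha₀, hau, ⟨v, ε₃ ^ 2 / (4 * M), max β₅ 0, Λ₅, κ, C₁, c, b, p6,
    hvK, hvs, hε, hκ, hC₁, fun β hβ => hgeom β (le_of_max_le_left hβ), fun β hβ => hv β (le_of_max_le_left hβ),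
    fun β hβ => hthick β (le_of_max_le_left hβ), fun β hβ => hBL β (le_of_max_le_left hβ), hMF⟩,
    floorsThreePoint_of_Q3MirrorFloor (Matrix.specialUnitaryGroup (Fin 2) ℂ) (fundamentalLatticeRep 2) a v g h hvK
      hgK hhK hvs hgs hhs hgh hε₃ hfloor⟩

end Summit.QuantumFields.YangMills.Cruxes.UVSeamRec.Q3MirrorFloors

end
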